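import Summits.CriticalPhenomena.Ising3DConformalLimit.Theorems.HarmonicMomentsIsotropyDilutionTransferLaplacian

/-!
# Fischer decomposition of powers of linear forms on `ℝ³` (radial part)

Support file for item `DilutionTransfer` (stmt-CriticalPhenomena-6037) of route
`HarmonicMomentsIsotropy` (sub-problem `Ising3DConformalLimit`); continues
`HarmonicMomentsIsotropyDilutionTransferLaplacian` (Laplacian calculus, harmonic projection).

* `fischer_decomposition` — every homogeneous `P` of degree `k` is `∑_{j ≤ k/2} |y|^{2j} H_j` with
  `H_j` harmonic homogeneous of degree `k - 2j` (Stein–Weiss 1971, Ch. IV, Thm. 2.1);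
* `lap_iterate_linForm_pow` — `Δʲ (L_ξ^{2j}) = (2j)! |ξ|^{2j}`;
* `fischer_linForm_pow` — the top (radial) Fischer component of `L_ξ^k` is `e_k |ξ|^k` with `e_k`
  INDEPENDENT of `ξ`;
* `harmonic_decomposition_linear_pow` — the same statement in definition-free vocabulary
  (`MvPolynomial.pderiv`, explicit sums), the form consumed by the measure-theoretic part.

References: E. M. Stein, G. Weiss, *Introduction to Fourier analysis on Euclidean spaces* (1971),
Ch. IV §2. Elementary and self-contained.
-/

noncomputable section

open MvPolynomial Finset

namespace Summit.CriticalPhenomena.Ising3DConformalLimit.Theorems.HarmonicMomentsIsotropy.Fischer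

/-! ## The Fischer decomposition -/

/-- **Fischer decomposition** (Stein–Weiss 1971, Ch. IV, Thm. 2.1): every homogeneous polynomial
`P` of degree `k` on `ℝ³` can be written `P = ∑_{j ≤ k/2} |y|^{2j} H_j` with `H_j` harmonic and
homogeneous of degree `k - 2j`. -/
theorem fischer_decomposition (k : ℕ) : ∀ P : Poly, P.IsHomogeneous k →
    ∃ H : ℕ → Poly, (∀ j, (H j).IsHomogeneous (k - 2 * j)) ∧ (∀ j, lap (H j) = 0) ∧
      P = ∑ j ∈ range (k / 2 + 1), rsq ^ j * H j := by
  induction k using Nat.strong_induction_on with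
  | _ k ih =>
    intro P hP
    rcases lt_or_ge k 2 with hk | hk
    · refine ⟨fun j => if j = 0 then P else 0, fun j => ?_, fun j => ?_, ?_⟩
      · by_cases hj : j = 0
        · subst hj; simpa using hP
        · simp only [hj, if_false]; exact isHomogeneous_zero _ _ _
      · by_cases hj : j = 0
        · subst hj; simpa using lap_eq_zero_of_isHomogeneous_le_one hP (by omega)
        · simp [hj]
      · have : k / 2 = 0 := by omega
        simp [this]
    · have hQ := fischerRem_isHomogeneous hP
      obtain ⟨H', hH'hom, hH'lap, hQeq⟩ := ih (k - 2) (by omega) _ hQ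
      refine ⟨fun j => if j = 0 then harmProj k P else H' (j - 1), fun j => ?_, fun j => ?_, ?_⟩
      · by_cases hj : j = 0
        · subst hj; simpa using harmProj_isHomogeneous hP
        · simp only [hj, if_false]
          have h := hH'hom (j - 1)
          have e : k - 2 - 2 * (j - 1) = k - 2 * j := by omega
          rwa [e] at h
      · by_cases hj : j = 0
        · subst hj; simpa using lap_harmProj hP
        · simp only [hj, if_false]; exact hH'lap _
      · have hk2 : k / 2 = (k - 2) / 2 + 1 := by omega
        calc P = harmProj k P + rsq * fischerRem k P := (harmProj_add_rsq_mul k P).symm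
          _ = harmProj k P + rsq * ∑ j ∈ range ((k - 2) / 2 + 1), rsq ^ j * H' j := by
              rw [← hQeq]
          _ = _ := by
              rw [hk2]
              conv_rhs => rw [Finset.sum_range_succ']
              simp only [Nat.add_sub_cancel, pow_zero, one_mul, Nat.add_one_ne_zero, if_false,
                if_true]
              rw [add_comm, Finset.mul_sum]
              congr 1
              exact Finset.sum_congr rfl fun j _ => by ring

/-- `Δ(L_ξ^{n+2}) = (n+2)(n+1)|ξ|² L_ξ^n`. -/
theorem lap_linForm_pow (ξ : Fin 3 → ℝ) (n : ℕ) :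
    lap (linForm ξ ^ (n + 2)) = (((n : ℝ) + 2) * (n + 1) * ∑ i, ξ i ^ 2) • linForm ξ ^ n := by
  have hterm : ∀ i : Fin 3, pderiv i (pderiv i (linForm ξ ^ (n + 2))) =
      (((n : ℝ) + 2) * (n + 1) * ξ i ^ 2) • linForm ξ ^ n := by
    intro i
    rw [pderiv_pow, pderiv_linForm, pderiv_mul, pderiv_mul, pderiv_C, mul_zero, add_zero,
      pderiv_pow, pderiv_linForm, smul_eq_C_mul]
    have h0 : pderiv i ((↑(n + 2) : Poly)) = 0 := by
      rw [← map_natCast (C : ℝ →+* Poly), pderiv_C]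
    rw [h0, zero_mul, zero_add]
    have e1 : n + 2 - 1 = n + 1 := rfl
    have e2 : n + 1 - 1 = n := rfl
    simp only [e1, e2, map_mul, map_add, map_natCast, map_pow, map_ofNat, map_one]
    push_cast
    ring
  rw [lap_apply, Finset.sum_congr rfl fun i _ => hterm i, ← Finset.sum_smul, ← Finset.mul_sum]

/-- `Δʲ(L_ξ^{2j}) = (2j)! |ξ|^{2j}`. -/
theorem lap_iterate_linForm_pow (ξ : Fin 3 → ℝ) (j : ℕ) :
    lap^[j] (linForm ξ ^ (2 * j)) = (((2 * j).factorial : ℝ) * (∑ i, ξ i ^ 2) ^ j) • (1 : Poly) := by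
  induction j with
  | zero => simp
  | succ j ih =>
    rw [Function.iterate_succ_apply, show 2 * (j + 1) = 2 * j + 2 by ring, lap_linForm_pow,
      lap_iterate_smul, ih, smul_smul]
    congr 1
    rw [show 2 * j + 2 = (2 * j + 1) + 1 by ring, Nat.factorial_succ, Nat.factorial_succ]
    push_cast
    ring

/-- **Fischer decomposition of `L_ξ^k` with explicit radial part.** There is a constant `e = e_k`,
independent of `ξ`, such that for every `ξ ∈ ℝ³`, `L_ξ^k = ∑_{j ≤ k/2} |y|^{2j} H_j` with `H_j`
harmonic homogeneous of degree `k - 2j` and, when `k = 2j` is even, `H_j = e |ξ|^{k}` (a constant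
polynomial). (Stein–Weiss 1971, Ch. IV §2; the radial part is identified by applying `Δ^{k/2}`.) -/
theorem fischer_linForm_pow (k : ℕ) : ∃ e : ℝ, ∀ ξ : Fin 3 → ℝ, ∃ H : ℕ → Poly,
    (∀ j, (H j).IsHomogeneous (k - 2 * j)) ∧ (∀ j, lap (H j) = 0) ∧
    (∀ j, 2 * j = k → H j = C (e * (∑ i, ξ i ^ 2) ^ j)) ∧
    linForm ξ ^ k = ∑ j ∈ range (k / 2 + 1), rsq ^ j * H j := by
  obtain ⟨γ, hγ, hγeq⟩ := lap_iterate_rsq_pow_self (k / 2)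
  refine ⟨(k.factorial : ℝ) / γ, fun ξ => ?_⟩
  have hhom : (linForm ξ ^ k).IsHomogeneous k := by
    simpa using (linForm_isHomogeneous ξ).pow k
  obtain ⟨H, hHhom, hHlap, hdec⟩ := fischer_decomposition k _ hhom
  refine ⟨H, hHhom, hHlap, fun j hj => ?_, hdec⟩
  subst hj
  have hJ : 2 * j / 2 = j := by omega
  rw [hJ] at hγeq
  -- `H j` is a constant
  have h0 : (H j).IsHomogeneous 0 := by
    have := hHhom j
    rwa [show 2 * j - 2 * j = 0 by omega] at this
  rw [← totalDegree_zero_iff_isHomogeneous, totalDegree_eq_zero_iff_eq_C] at h0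
  set h : ℝ := coeff 0 (H j) with hh
  -- apply `Δʲ` to the decomposition
  have happly := congrArg (fun Q => lap^[j] Q) hdec
  rw [lap_iterate_linForm_pow, lap_iterate_sum, hJ, Finset.sum_range_succ,
    Finset.sum_eq_zero (fun i hi => lap_iterate_rsq_pow_mul_harmonic_eq_zero (hHhom i) (hHlap i)
      i j (Finset.mem_range.1 hi)), zero_add, h0, mul_comm (rsq ^ j) (C h), ← smul_eq_C_mul, lap_iterate_smul,
    hγeq, smul_smul] at happly
  -- compare the coefficients of `1`
  have hcoef : ((2 * j).factorial : ℝ) * (∑ i, ξ i ^ 2) ^ j = h * γ := by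
    have := congrArg (fun Q : Poly => coeff 0 Q) happly
    simpa using this
  rw [h0]
  congr 1
  rw [div_mul_eq_mul_div, hcoef, mul_div_assoc, div_self hγ, mul_one]


/-- **Harmonic decomposition of `(ξ·y)^k`, definition-free form.** For every `k` there is a real
constant `e` such that for every `ξ ∈ ℝ³` the polynomial `(∑ ξᵢ Xᵢ)^k` equals
`∑_{j ≤ k/2} (∑ Xᵢ²)^j · H_j` with `H_j` homogeneous of degree `k - 2j`, `∑ᵢ ∂ᵢ²H_j = 0`, and
`H_{k/2} = e (∑ ξᵢ²)^{k/2}` when `k` is even. (Stein–Weiss 1971, Ch. IV §2.) -/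
theorem harmonic_decomposition_linear_pow (k : ℕ) : ∃ e : ℝ, ∀ ξ : Fin 3 → ℝ,
    ∃ H : ℕ → MvPolynomial (Fin 3) ℝ,
      (∀ j, (H j).IsHomogeneous (k - 2 * j)) ∧
      (∀ j, (∑ i : Fin 3, pderiv i (pderiv i (H j))) = 0) ∧
      (∀ j, 2 * j = k → H j = C (e * (∑ i, ξ i ^ 2) ^ j)) ∧
      (∑ i : Fin 3, C (ξ i) * X i) ^ k =
        ∑ j ∈ range (k / 2 + 1), (∑ i : Fin 3, X i ^ 2) ^ j * H j := by
  obtain ⟨e, he⟩ := fischer_linForm_pow k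
  refine ⟨e, fun ξ => ?_⟩
  obtain ⟨H, h1, h2, h3, h4⟩ := he ξ
  refine ⟨H, h1, fun j => ?_, h3, ?_⟩
  · rw [← lap_apply]; exact h2 j
  · exact h4

end Summit.CriticalPhenomena.Ising3DConformalLimit.Theorems.HarmonicMomentsIsotropy.Fischer

end
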